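import Literature.Computability.MetaComplexity.ScopeExpansionProofs
import HarnessLib

/-!
# First-moment counts for the random `k`-CNF `F_k(n, Δn)`: unsatisfiability and expansion at a
fixed linear radius

Support file for the discharge of the named fact `chvatal_szemeredi` (`RandomCNFResolution.lean`,
Chvátal–Szemerédi 1988). Both probabilistic ingredients of the Chvátal–Szemerédi theorem in the
Ben-Sasson–Wigderson rendering are first-moment (union) bounds over the i.i.d. model
`randomKCNF k n m` = uniform law on clause tuples `Fin m → kClauses k n` (`RandomCNF.lean`,
`RandomScopes.lean`); we state them as COUNTS of bad tuples, the probability glue being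
`randomKCNF_toOuterMeasure_ge`.

* `card_le_of_forall_satisfiable` — **unsatisfiability** (Chvátal–Szemerédi 1988, §1; Franco–Paull
  1983): the tuples whose formula is satisfiable number at most `2^n · (C(n,k) (2^k - 1))^m`
  (`= 2^n (1 - 2^{-k})^m · |kClauses k n|^m`): a fixed assignment satisfies a uniform `k`-clause
  with probability exactly `1 - 2^{-k}` (for each `k`-set of variables exactly one of the `2^k`
  sign patterns is falsified, `card_filter_eval_le`), the `m` clauses are independent, and there
  are `2^n` assignments to the `n` variables.
* `card_le_of_forall_not_isCoverExpander_linear` — **cover expansion at radius `κ n`**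
  (Chvátal–Szemerédi 1988, Lemma 1 (sparsity of random hypergraphs); Ben-Sasson–Wigderson 2001,
  Lemma 6.6 / Beame–Karp–Pitassi–Saks): with `a = (2k+1)/4`, `B = e^{1+a} Δ a` and any radius `N`
  with `a N ≤ n / (2B)^4`, the tuples of `Δ n` clauses whose scope family is NOT an
  `(N, a)`-cover expander number at most `(32 a B^4 / n) · |kClauses k n|^{Δn}`. So at the FIXED
  radius fraction `κ = 1/(a (2B)^4)` the failure probability is `O(1/n)` — unlike the KMOW form
  `kmow_random_kCNF_plausible` (fixed failure probability `β`, radius shrinking with `β`), this is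
  what an almost-sure `exp(Ω(n))` size bound needs. The count is the tree's union bound
  `card_le_of_forall_not_isCoverExpander` with the per-size estimate `fixedRadius_term_le`:
  `C(Δn,c) C(n,t) (C(t,k)/C(n,k))^c ≤ (2B)^4 (a c / n) 2^{-c}` for `t < a c ≤ t + 1`, because the
  closed form `(eΔn/c)^c e^t (t/n)^{kc-t}` (`term_le_closed_form`) has `kc - t ≥ c + E` with
  `E ≥ (k - 1 - a) c ≥ c/4` spare factors `t/n ≤ 1/(2B)^4`.

## References

* V. Chvátal, E. Szemerédi, *Many hard examples for resolution*, J. ACM 35 (1988) 759–768, §1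
  (first moment for unsatisfiability), Lemma 1 (random hypergraphs are sparse/expanding).
* E. Ben-Sasson, A. Wigderson, *Short proofs are narrow — resolution made simple*, J. ACM 48
  (2001) 149–169, §6.3, Lemma 6.6, Appendix (the union bound).
* J. Franco, M. Paull, *Probabilistic analysis of the Davis–Putnam procedure for solving the
  satisfiability problem*, Discrete Appl. Math. 5 (1983) 77–87 (first-moment unsatisfiability).
-/

noncomputable section

open Finset Real Literature.Computability.Complexity

namespace Literature.Computability.MetaComplexity

/-! ### Unsatisfiability: a fixed assignment versus a uniform clause -/

/-- The value of a clause depends only on the values of its variables. [folklore] -/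
theorem clause_eval_congr {σ σ' : ℕ → Bool} {C : Clause ℕ} (h : ∀ l ∈ C, σ l.1 = σ' l.1) :
    Clause.eval σ C = Clause.eval σ' C := by
  induction C with
  | nil => rfl
  | cons l C ih =>
    have ih' := ih fun l' hl' => h l' (List.mem_cons_of_mem _ hl')
    simp only [Clause.eval, List.any_cons] at ih' ⊢
    rw [ih', Literal.eval, Literal.eval, h l List.mem_cons_self]

/-- **One falsified pattern per variable set.** For a fixed total assignment `σ`, at least
`C(n, k)` of the clauses of `kClauses k n` are FALSE under `σ` (for each `k`-set `S` the clause on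
`S` whose every literal disagrees with `σ`). [Chvátal–Szemerédi 1988, §1 ("a fixed truth
assignment satisfies a random clause with probability `1 - 2^{-k}`")] [folklore] -/
theorem choose_le_card_filter_eval_false (k n : ℕ) (σ : ℕ → Bool) :
    n.choose k ≤ ((kClauses k n).filter fun x => Clause.eval σ x = false).card := by
  classical
  -- the falsified clause on the variable set `S`
  set vars : Finset (Fin n) → List ℕ := fun S => (S.sort (· ≤ ·)).map fun v : Fin n => (v : ℕ)
    with hvars
  set pat : Finset (Fin n) → (Fin k → Bool) := fun S i => ! σ ((vars S).getD i 0) with hpat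
  set ext : (Fin k → Bool) → ℕ → Bool := fun e i => if h : i < k then e ⟨i, h⟩ else false
    with hext
  have hmem : ∀ S ∈ (univ : Finset (Fin n)).powersetCard k,
      clauseOf S (ext (pat S)) ∈ (kClauses k n).filter fun x => Clause.eval σ x = false := by
    intro S hS
    have hSk : S.card = k := (mem_powersetCard.1 hS).2
    refine mem_filter.2 ⟨?_, ?_⟩
    · unfold kClauses
      exact mem_image.2 ⟨(S, pat S), mem_product.2 ⟨hS, mem_univ _⟩, rfl⟩
    · -- every literal of the clause is false under `σ`
      unfold Clause.eval
      rw [List.any_eq_false]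
      intro l hl
      unfold clauseOf at hl
      rw [List.mem_map] at hl
      obtain ⟨p, hp, rfl⟩ := hl
      have h1 := List.mem_zipIdx_iff_getElem?.1 hp
      obtain ⟨hlt, hpx⟩ := List.getElem?_eq_some_iff.1 h1
      have hlen : p.2 < k := by simpa [hSk] using hlt
      have hgetD : (vars S).getD p.2 0 = p.1 := by
        rw [hvars]
        simp only [List.getD_eq_getElem?_getD, h1, Option.getD_some]
      simp only [Literal.eval, hext, hpat, dif_pos hlen, hgetD]
      cases σ p.1 <;> simp
  have hinj : Set.InjOn (fun S => clauseOf S (ext (pat S)))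
      ((univ : Finset (Fin n)).powersetCard k : Set (Finset (Fin n))) := by
    intro S _ T _ hST
    have h := congrArg clauseScope hST
    simp only [clauseScope_clauseOf] at h
    exact Finset.map_injective _ h
  calc n.choose k = ((univ : Finset (Fin n)).powersetCard k).card := by
        rw [card_powersetCard, card_univ, Fintype.card_fin]
    _ ≤ _ := card_le_card_of_injOn _ hmem hinj

/-- Hence at most `C(n,k) (2^k - 1)` clauses of `kClauses k n` are TRUE under a fixed assignment
(`|kClauses k n| = C(n,k) 2^k`, `card_kClauses`). [Chvátal–Szemerédi 1988, §1] [folklore] -/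
theorem card_filter_eval_le (k n : ℕ) (σ : ℕ → Bool) :
    ((kClauses k n).filter fun x => Clause.eval σ x = true).card ≤ n.choose k * (2 ^ k - 1) := by
  have h1 := Finset.card_filter_add_card_filter_not
    (s := kClauses k n) (fun x => Clause.eval σ x = true)
  have h2 : ((kClauses k n).filter fun x => ¬ Clause.eval σ x = true) =
      (kClauses k n).filter fun x => Clause.eval σ x = false := by
    simp only [Bool.not_eq_true]
  rw [h2, card_kClauses] at h1
  have h3 := choose_le_card_filter_eval_false k n σ
  have h4 : n.choose k * (2 ^ k - 1) = n.choose k * 2 ^ k - n.choose k := Nat.mul_sub_one _ _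
  omega

/-- **First moment for unsatisfiability** (Chvátal–Szemerédi 1988, §1; Franco–Paull 1983): among
the `|kClauses k n|^m` tuples of `m` clauses, those whose formula is satisfiable number at most
`2^n · (C(n,k) (2^k - 1))^m`, i.e. a `2^n (1 - 2^{-k})^m` fraction: union over the `2^n`
assignments to `x₀ … x_{n-1}` (the clauses mention no other variable) of the product count
"all `m` clauses are satisfied by the assignment". [Chvátal–Szemerédi 1988, §1]
[cite: ChvatalSzemeredi1988, §1] -/
theorem card_le_of_forall_satisfiable {k n m : ℕ} (bad : Finset (Fin m → ↥(kClauses k n)))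
    (hbad : ∀ c ∈ bad, CNF.Satisfiable (List.ofFn fun i => (c i : Clause ℕ))) :
    bad.card ≤ 2 ^ n * (n.choose k * (2 ^ k - 1)) ^ m := by
  classical
  -- the assignment extending `τ : Fin n → Bool` by `false`
  set extτ : (Fin n → Bool) → ℕ → Bool := fun τ x => if h : x < n then τ ⟨x, h⟩ else false
    with hextτ
  set A : (Fin n → Bool) → Finset ↥(kClauses k n) :=
    fun τ => univ.filter fun x => Clause.eval (extτ τ) (x : Clause ℕ) = true with hA
  -- covering: a satisfiable tuple is satisfied by some `extτ τ`
  have hcover : bad ⊆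
      (univ : Finset (Fin n → Bool)).biUnion fun τ =>
        univ.filter fun c : Fin m → ↥(kClauses k n) => ∀ i ∈ (univ : Finset (Fin m)), c i ∈ A τ := by
    intro c hc
    obtain ⟨σ, hσ⟩ := hbad c hc
    rw [CNF.eval_eq_true_iff] at hσ
    refine mem_biUnion.2 ⟨fun j => σ j, mem_univ _, mem_filter.2 ⟨mem_univ _, fun i _ => ?_⟩⟩
    rw [hA, mem_filter]
    refine ⟨mem_univ _, ?_⟩
    have hi : Clause.eval σ (c i : Clause ℕ) = true :=
      hσ _ (List.mem_ofFn.2 ⟨i, rfl⟩)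
    rw [← hi]
    refine clause_eval_congr fun l hl => ?_
    have hl' : l.1 ∈ clauseScope (c i : Clause ℕ) := mem_clauseScope.2 ⟨l.2, hl⟩
    have hlt : l.1 < n := by simpa using clauseScope_subset_range (c i).2 hl'
    simp [hextτ, hlt]
  -- the count for one assignment
  have hone : ∀ τ : Fin n → Bool,
      (univ.filter fun c : Fin m → ↥(kClauses k n) => ∀ i ∈ (univ : Finset (Fin m)), c i ∈ A τ).card
        ≤ (n.choose k * (2 ^ k - 1)) ^ m := by
    intro τ
    rw [card_filter_forall_mem, card_univ, Fintype.card_fin, Nat.sub_self, pow_zero, mul_one]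
    refine Nat.pow_le_pow_left ?_ m
    calc (A τ).card = ((A τ).map (Function.Embedding.subtype _)).card := (card_map _).symm
      _ ≤ ((kClauses k n).filter fun x => Clause.eval (extτ τ) x = true).card := by
          refine card_le_card fun x hx => ?_
          rw [mem_map] at hx
          obtain ⟨y, hy, rfl⟩ := hx
          rw [hA, mem_filter] at hy
          exact mem_filter.2 ⟨y.2, hy.2⟩
      _ ≤ n.choose k * (2 ^ k - 1) := card_filter_eval_le k n _
  calc _ ≤ _ := card_le_card hcover
    _ ≤ ∑ τ : Fin n → Bool, (univ.filter fun c : Fin m → ↥(kClauses k n) =>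
          ∀ i ∈ (univ : Finset (Fin m)), c i ∈ A τ).card := card_biUnion_le
    _ ≤ ∑ _τ : Fin n → Bool, (n.choose k * (2 ^ k - 1)) ^ m := sum_le_sum fun τ _ => hone τ
    _ = 2 ^ n * (n.choose k * (2 ^ k - 1)) ^ m := by
        rw [sum_const, card_univ, Fintype.card_fun, Fintype.card_bool, Fintype.card_fin,
          smul_eq_mul]

/-! ### Cover expansion at a fixed linear radius -/

/-- `Σ_{c=1}^{N} c 2^{-c} ≤ 2`. [folklore] -/
theorem sum_Ico_mul_half_pow_le_two (N : ℕ) :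
    ∑ c ∈ Finset.Ico 1 (N + 1), (c : ℝ) * (1 / 2) ^ c ≤ 2 := by
  have key : ∀ N : ℕ, ∑ c ∈ Finset.Ico 1 (N + 1), (c : ℝ) * (1 / 2) ^ c =
      2 - ((N : ℝ) + 2) * (1 / 2) ^ N := by
    intro N
    induction N with
    | zero => norm_num
    | succ N ih =>
      rw [Finset.sum_Ico_succ_top (by omega), ih]
      push_cast
      ring
  rw [key]
  have : (0 : ℝ) ≤ ((N : ℝ) + 2) * (1 / 2) ^ N := by positivity
  linarith

/-- **The per-size estimate at fixed radius.** With `a = (2k+1)/4` (`k ≥ 3`), `B = e^{1+a} Δ a`,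
a family size `c ≥ 1`, the integer `t` with `t < a c ≤ t + 1`, `t ≤ n`, and `a c ≤ n/(2B)^4`:
`C(Δn, c) · C(n, t) · (C(t,k)/C(n,k))^c ≤ (2B)^4 · (a c / n) · 2^{-c}` — the expected number of
`c`-families of clauses of `F_k(n, Δn)` covering at most `t` variables.
[Ben-Sasson–Wigderson 2001, Lemma 6.6 (Appendix); Chvátal–Szemerédi 1988, Lemma 1] [folklore] -/
theorem fixedRadius_term_le {k Δ n c t : ℕ} {a B : ℝ} (hk : 3 ≤ k) (hΔ : 1 ≤ Δ)
    (ha : a = (2 * k + 1) / 4) (hB : B = Real.exp (1 + a) * Δ * a) (hc : 1 ≤ c)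
    (ht1 : (t : ℝ) < a * c) (ht2 : a * c ≤ t + 1) (htn : t ≤ n)
    (hy : a * c ≤ n / (2 * B) ^ 4) :
    ((Δ * n).choose c : ℝ) * n.choose t * ((t.choose k : ℝ) / n.choose k) ^ c ≤
      (2 * B) ^ 4 * (a * c / n) * (1 / 2) ^ c := by
  have hk3 : (3 : ℝ) ≤ k := by exact_mod_cast hk
  have hc1 : (1 : ℝ) ≤ c := by exact_mod_cast hc
  have hΔ1 : (1 : ℝ) ≤ Δ := by exact_mod_cast hΔ
  have ha74 : (7 : ℝ) / 4 ≤ a := by rw [ha]; linarith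
  have hapos : 0 < a := by linarith
  have hak : a + 5 / 4 ≤ k := by rw [ha]; linarith
  have ht0 : 1 ≤ t := by
    have h : (0 : ℝ) < t := by nlinarith
    exact_mod_cast h
  have ht' : (0 : ℝ) < t := by exact_mod_cast ht0
  have htk : t ≤ k * c := by
    have h : (t : ℝ) ≤ k * c := by nlinarith
    exact_mod_cast h
  have hn : 1 ≤ n := ht0.trans htn
  have hn' : (0 : ℝ) < n := by exact_mod_cast hn
  have htc : t + c < k * c := by
    have h : (t : ℝ) + c < k * c := by nlinarith
    exact_mod_cast h
  -- the spare exponent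
  set E : ℕ := k * c - t - c with hE
  have hE1 : 1 ≤ E := by omega
  have hEcast : (E : ℝ) = k * c - t - c := by
    rw [hE, Nat.cast_sub (by omega), Nat.cast_sub (by omega), Nat.cast_mul]
  have h4E : (c : ℝ) ≤ 4 * E := by
    rw [hEcast]
    have h1 : 4 * (t : ℝ) < (2 * k + 1) * c := by rw [ha] at ht1; linarith
    nlinarith [mul_nonneg (by linarith : (0 : ℝ) ≤ c) (by linarith : (0 : ℝ) ≤ (k : ℝ) - 3)]
  have h4E' : c ≤ 4 * E := by exact_mod_cast h4E
  -- the base `B`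
  have hBpos : 0 < B := by rw [hB]; positivity
  have h2B : (1 : ℝ) ≤ 2 * B := by
    rw [hB]
    have h1 : (1 : ℝ) ≤ Real.exp (1 + a) := Real.one_le_exp (by linarith)
    nlinarith [mul_le_mul h1 hΔ1 (by norm_num) (by linarith : (0 : ℝ) ≤ Real.exp (1 + a))]
  have hBe : exp 1 * Δ * a * exp a = B := by rw [hB, Real.exp_add]; ring
  -- Step A: the closed form
  have hA := term_le_closed_form (m := Δ * n) (k := k) hc ht0 htn htk
  have hx0 : (0 : ℝ) ≤ t / n := by positivity
  have hsplit : ((t : ℝ) / n) ^ (k * c - t) =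
      ((t : ℝ) / n) ^ c * (((t : ℝ) / n) * ((t : ℝ) / n) ^ (E - 1)) := by
    have : k * c - t = c + (E - 1 + 1) := by omega
    rw [this, pow_add, pow_succ]
    ring
  have hC1 : (exp 1 * ((Δ * n : ℕ) : ℝ) / c) ^ c * ((t : ℝ) / n) ^ c ≤ (exp 1 * Δ * a) ^ c := by
    rw [← mul_pow]
    apply pow_le_pow_left₀ (by positivity)
    rw [Nat.cast_mul]
    have h1 : exp 1 * ((Δ : ℝ) * n) / c * (t / n) = exp 1 * Δ * (t / c) := by
      field_simp
    rw [h1]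
    have htc' : (t : ℝ) / c ≤ a := by
      rw [div_le_iff₀ (by positivity)]
      linarith
    gcongr
  have hC2 : exp 1 ^ t ≤ (exp a) ^ c := by
    rw [exp_one_pow, ← Real.exp_nat_mul]
    exact Real.exp_le_exp.2 (by nlinarith)
  have hy' : (t : ℝ) / n ≤ ((2 * B) ^ 4)⁻¹ := by
    rw [div_le_iff₀ hn']
    calc (t : ℝ) ≤ a * c := ht1.le
      _ ≤ n / (2 * B) ^ 4 := hy
      _ = ((2 * B) ^ 4)⁻¹ * n := by rw [div_eq_mul_inv, mul_comm]
  -- the key estimate: `B^c y^{E-1} ≤ (2B)^4 2^{-c}` for `y = (2B)^{-4}`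
  have hkey : B ^ c * (((2 * B) ^ 4)⁻¹) ^ (E - 1) ≤ (2 * B) ^ 4 * (1 / 2) ^ c := by
    have e1 : B ^ c = (2 * B) ^ c * (1 / 2) ^ c := by rw [← mul_pow]; congr 1; ring
    have e2 : (2 * B) ^ (4 * E) = (2 * B) ^ 4 * ((2 * B) ^ 4) ^ (E - 1) := by
      rw [pow_mul]
      conv_lhs => rw [show E = E - 1 + 1 by omega, pow_succ]
      ring
    have h3 : (2 * B) ^ c * (((2 * B) ^ 4)⁻¹) ^ (E - 1) ≤ (2 * B) ^ 4 :=
      calc (2 * B) ^ c * (((2 * B) ^ 4)⁻¹) ^ (E - 1)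
          ≤ (2 * B) ^ (4 * E) * (((2 * B) ^ 4)⁻¹) ^ (E - 1) := by
            gcongr
        _ = (2 * B) ^ 4 * ((2 * B) ^ 4 * ((2 * B) ^ 4)⁻¹) ^ (E - 1) := by
            rw [e2, mul_pow ((2 * B) ^ 4) (((2 * B) ^ 4)⁻¹) (E - 1), mul_assoc]
        _ = (2 * B) ^ 4 := by
            rw [mul_inv_cancel₀ (by positivity), one_pow, mul_one]
    calc B ^ c * (((2 * B) ^ 4)⁻¹) ^ (E - 1)
        = (2 * B) ^ c * (((2 * B) ^ 4)⁻¹) ^ (E - 1) * (1 / 2) ^ c := by rw [e1]; ring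
      _ ≤ (2 * B) ^ 4 * (1 / 2) ^ c := by gcongr
  -- assembly
  calc ((Δ * n).choose c : ℝ) * n.choose t * ((t.choose k : ℝ) / n.choose k) ^ c
      ≤ (exp 1 * ((Δ * n : ℕ) : ℝ) / c) ^ c * exp 1 ^ t * ((t : ℝ) / n) ^ (k * c - t) := hA
    _ = ((exp 1 * ((Δ * n : ℕ) : ℝ) / c) ^ c * ((t : ℝ) / n) ^ c) * exp 1 ^ t *
          (((t : ℝ) / n) * ((t : ℝ) / n) ^ (E - 1)) := by rw [hsplit]; ring
    _ ≤ (exp 1 * Δ * a) ^ c * (exp a) ^ c *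
          (((t : ℝ) / n) * (((2 * B) ^ 4)⁻¹) ^ (E - 1)) := by gcongr
    _ = B ^ c * (((2 * B) ^ 4)⁻¹) ^ (E - 1) * ((t : ℝ) / n) := by rw [← mul_pow, hBe]; ring
    _ ≤ (2 * B) ^ 4 * (1 / 2) ^ c * ((t : ℝ) / n) := by gcongr
    _ ≤ (2 * B) ^ 4 * (1 / 2) ^ c * (a * c / n) := by gcongr
    _ = (2 * B) ^ 4 * (a * c / n) * (1 / 2) ^ c := by ring

/-- **First moment for cover expansion at a fixed linear radius** (Chvátal–Szemerédi 1988,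
Lemma 1; Ben-Sasson–Wigderson 2001, Lemma 6.6): with `a = (2k+1)/4`, `B = e^{1+a} Δ a` and a
radius `N` with `a N ≤ n / (2B)^4`, the tuples of `Δ n` clauses from `kClauses k n ≠ ∅` whose
scope family is not an `(N, a)`-cover expander number at most `(32 a B^4 / n) |kClauses k n|^{Δn}`.
[Chvátal–Szemerédi 1988, Lemma 1] [cite: ChvatalSzemeredi1988, Lemma 1] -/
theorem card_le_of_forall_not_isCoverExpander_linear {k Δ n N : ℕ} {a B : ℝ} (hk : 3 ≤ k)
    (hΔ : 1 ≤ Δ) (hn : 1 ≤ n) (hK : (kClauses k n).Nonempty) (ha : a = (2 * k + 1) / 4)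
    (hB : B = Real.exp (1 + a) * Δ * a) (hN : a * N ≤ n / (2 * B) ^ 4)
    (bad : Finset (Fin (Δ * n) → ↥(kClauses k n)))
    (hbad : ∀ c ∈ bad, ¬ IsCoverExpander (fun i => clauseScope (c i : Clause ℕ)) N a) :
    (bad.card : ℝ) ≤ 32 * a * B ^ 4 / n * ((((kClauses k n).card ^ (Δ * n) : ℕ)) : ℝ) := by
  classical
  have hk3 : (3 : ℝ) ≤ k := by exact_mod_cast hk
  have hΔ1 : (1 : ℝ) ≤ Δ := by exact_mod_cast hΔ
  have hn' : (0 : ℝ) < n := by exact_mod_cast hn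
  have ha74 : (7 : ℝ) / 4 ≤ a := by rw [ha]; linarith
  have hapos : 0 < a := by linarith
  have hBpos : 0 < B := by rw [hB]; positivity
  have h2B : (1 : ℝ) ≤ 2 * B := by
    rw [hB]
    have h1 : (1 : ℝ) ≤ Real.exp (1 + a) := Real.one_le_exp (by linarith)
    nlinarith [mul_le_mul h1 hΔ1 (by norm_num) (by linarith : (0 : ℝ) ≤ Real.exp (1 + a))]
  have h2B4 : (1 : ℝ) ≤ (2 * B) ^ 4 := one_le_pow₀ h2B
  have haN : a * N ≤ n := hN.trans (div_le_self hn'.le h2B4)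
  have hcount := card_le_of_forall_not_isCoverExpander (k := k) hapos.le haN bad hbad
  have hKc : (kClauses k n).card = n.choose k * 2 ^ k := card_kClauses k n
  have hKpos : 0 < (kClauses k n).card := card_pos.2 hK
  have hchoose : 0 < n.choose k := by
    refine Nat.pos_of_ne_zero fun h => ?_
    rw [hKc, h, zero_mul] at hKpos
    exact lt_irrefl _ hKpos
  set K : ℝ := ((kClauses k n).card : ℝ) with hKdef
  have hKreal : K = (n.choose k : ℝ) * 2 ^ k := by rw [hKdef, hKc]; push_cast; ring
  have hch' : (0 : ℝ) < n.choose k := by exact_mod_cast hchoose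
  -- the per-size bound
  have hterm : ∀ c ∈ Finset.Ico 1 (N + 1),
      ((Δ * n).choose c : ℝ) * ((n.choose (⌈a * c⌉₊ - 1) : ℝ) *
        ((((⌈a * c⌉₊ - 1).choose k : ℝ) * 2 ^ k) ^ c * K ^ (Δ * n - c))) ≤
      K ^ (Δ * n) * ((2 * B) ^ 4 * (a * c / n) * (1 / 2) ^ c) := by
    intro c hc
    rw [Finset.mem_Ico] at hc
    obtain ⟨hc1, hcN⟩ := hc
    have hcN' : c ≤ N := Nat.lt_succ_iff.1 hcN
    have hcNr : (c : ℝ) ≤ N := by exact_mod_cast hcN'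
    set t : ℕ := ⌈a * c⌉₊ - 1 with htdef
    have hac : 0 < a * c := by positivity
    have hceil : 1 ≤ ⌈a * (c : ℝ)⌉₊ := Nat.one_le_iff_ne_zero.2 (Nat.ceil_pos.2 hac).ne'
    have htcast : (t : ℝ) = ⌈a * (c : ℝ)⌉₊ - 1 := by
      rw [htdef, Nat.cast_sub hceil, Nat.cast_one]
    have ht1 : (t : ℝ) < a * c := by
      rw [htcast]
      linarith [Nat.ceil_lt_add_one hac.le]
    have ht2 : a * c ≤ t + 1 := by
      rw [htcast]
      linarith [Nat.le_ceil (a * c)]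
    have hy : a * c ≤ n / (2 * B) ^ 4 := (mul_le_mul_of_nonneg_left hcNr hapos.le).trans hN
    have htn : t ≤ n := by
      have h1 : a * c ≤ n := (mul_le_mul_of_nonneg_left hcNr hapos.le).trans haN
      have h2 := Nat.ceil_le.2 h1
      omega
    have hT := fixedRadius_term_le hk hΔ ha hB hc1 ht1 ht2 htn hy
    by_cases hcm : c ≤ Δ * n
    · have hsplit : K ^ (Δ * n) = K ^ c * K ^ (Δ * n - c) := (pow_mul_pow_sub K hcm).symm
      have hfac : ((t.choose k : ℝ)) * 2 ^ k = K * ((t.choose k : ℝ) / n.choose k) := by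
        rw [hKreal]
        field_simp
      calc ((Δ * n).choose c : ℝ) * ((n.choose t : ℝ) *
            ((((t.choose k : ℝ)) * 2 ^ k) ^ c * K ^ (Δ * n - c)))
          = K ^ (Δ * n) * ((((Δ * n).choose c : ℝ)) * n.choose t *
              ((t.choose k : ℝ) / n.choose k) ^ c) := by
            rw [hfac, mul_pow, hsplit]
            ring
        _ ≤ K ^ (Δ * n) * ((2 * B) ^ 4 * (a * c / n) * (1 / 2) ^ c) :=
            mul_le_mul_of_nonneg_left hT (by positivity)
    · have h0 : (Δ * n).choose c = 0 := Nat.choose_eq_zero_of_lt (not_le.1 hcm)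
      rw [h0, Nat.cast_zero, zero_mul]
      positivity
  -- summing up
  calc (bad.card : ℝ)
      ≤ ∑ c ∈ Finset.Ico 1 (N + 1), ((Δ * n).choose c : ℝ) * ((n.choose (⌈a * c⌉₊ - 1) : ℝ) *
          ((((⌈a * c⌉₊ - 1).choose k : ℝ) * 2 ^ k) ^ c * K ^ (Δ * n - c))) := by
        rw [hKdef]
        exact_mod_cast hcount
    _ ≤ ∑ c ∈ Finset.Ico 1 (N + 1), K ^ (Δ * n) * ((2 * B) ^ 4 * (a * c / n) * (1 / 2) ^ c) :=
        sum_le_sum hterm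
    _ = K ^ (Δ * n) * ((2 * B) ^ 4 * (a / n)) *
          ∑ c ∈ Finset.Ico 1 (N + 1), (c : ℝ) * (1 / 2) ^ c := by
        rw [mul_sum]
        refine sum_congr rfl fun c _ => ?_
        ring
    _ ≤ K ^ (Δ * n) * ((2 * B) ^ 4 * (a / n)) * 2 := by
        gcongr
        exact sum_Ico_mul_half_pow_le_two N
    _ = 32 * a * B ^ 4 / n * ((((kClauses k n).card ^ (Δ * n) : ℕ)) : ℝ) := by
        rw [hKdef]
        push_cast
        ring

end Literature.Computability.MetaComplexity
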